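import Summits.ResolutionOfSingularities.ResolutionOfSingularities.Theorems.FrobeniusLadderFInjectiveMacaulayficationLocallyFixable
import Summits.ResolutionOfSingularities.ResolutionOfSingularities.Theorems.FrobeniusLadderFInjectiveMacaulayficationPointFixableCentre
import Summits.ResolutionOfSingularities.ResolutionOfSingularities.Theorems.FrobeniusLadderFInjectiveMacaulayficationBadPointsClosed
import Literature.AlgebraicGeometry.Resolution.BlowupsExistence
import Literature.AlgebraicGeometry.Resolution.BlowupStalkBlowupAlgebra
import Mathlib.Algebra.CharP.Algebra
import HarnessLib

/-!
# §5g/§5c T-𝒫-loc — POINT-FIXABLE ⇒ LOCALLY FIXABLE, and THEOREM A-loc in the ring-local currency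
(crux `FInjectiveMacaulayfication`, chain w45a)

Support file for crux stmt-ResolutionOfSingularities-15315 (`FrobeniusLadder.FInjectiveMacaulayfication`), chain w45a, seat
res-L1-w45a-stub-1 (RULINGS R11.7 / R11.14 of res-L1-w45a-plan-1). [OURS · L1 W4.5a] — NOT a statement of the manuscript under
review; AI-written, weaker than expert review.

Two presentations of the point-fixable class: the RING-LOCAL form `PFix(𝒪_{X₁,b})` (`L/w45a/ClassGlueSig.lean` v3 sha16
74b6a04e74c75940 §5 = v4 40b76d9590170192 §5: SOME `𝔪_b`-primary `(c) ≠ 0` of `𝒪_b` all of whose affine blowup algebras `𝒪_b[(c)/c_j]` satisfy the full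
clause at the primes over `𝔪_b`) and the CHART form `P_locα` (`LocallyFixable`, statements of record 424b4d2281bd594a: an affine
`U ∋ b` inside any prescribed `W`, `b` alone bad on `U`, `char Γ(U) = p`, an ideal `I ≠ 0` of zero locus `{b}` with every stalk of
`affineBlowup I` over `b` good). This file is the BRIDGE 5g and its corollary, v3's 5c by name:

* `exists_pointCentre_of_pointFixable` — the point-centre `J` of the spread-out centre `Ĩ = (c) ∩ Γ(X₁, U)` on ANY affine `U ∋ b`
  (`J(U) = Ĩ`, `supp J = {b}`), all of whose blowing ups satisfy the full clause over `b` (the proof of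
  `PointFixableCentre.pointFixable_h4`, with `J(U)` exposed);
* `affineBlowupClause_of_pointCentre` — if every blowing up along `J` is good over `b` then every stalk of `affineBlowup (J(U))`
  over `b` is good: a blowing up `X'` along `J` EXISTS (`Literature…exists_isBlowup`) and `affineBlowup (J(U))` is an open chart
  of it over `U` (`IsBlowup.exists_chartImmersion`);
* `locallyFixable_of_pointFixable` (5g) — `ClassGlueSig` v4 40b76d9590170192 l.502 `stub_locallyFixable_of_pointFixable` VERBATIM:
  `ADM(X₁) → b` closed bad `→ PFix(𝒪_b) → P_locα(b)`: ALL bad points of an admissible pair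
  are closed (`BadPointsClosed.stub_badPointsClosed`), so the other bad points form a closed finite set missing `b` and an affine
  chart `U ∋ b` inside `W` avoids them; `char Γ(U) = p` from `k → Γ(X₁, ⊤) → Γ(X₁, U)`; `Ĩ ≠ 0` with zero locus `{b}`
  (`PointFixableCentre.under_le_primeIdealOf_iff`); the clause over `b` by the two lemmas above;
* `fInjectiveMacaulayfication_of_pointFixable` — `ClassGlueSig` v3 §5c VERBATIM = THEOREM A-loc in the `PFix` currency: every
  admissible pair ALL of whose bad points are point-fixable has the crux's model — `LocallyFixable.fInjectiveMacaulayfication_of_locallyFixable`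
  (THEOREM A-locα, p510664) after 5g pointwise (bad points are closed). No 5b′ (`PFix` transport) is needed.

No definitions, no named facts, no `sorry`. [folklore]
-/

-- single-problem summit: the doubled namespace component is forced
set_option linter.dupNamespace false

noncomputable section

namespace Summit.ResolutionOfSingularities.ResolutionOfSingularities.Theorems.FInjectiveMacaulayfication.OfPointFixable

open AlgebraicGeometry CategoryTheory Literature.AlgebraicGeometry.Resolution TopologicalSpace
open Summit.ResolutionOfSingularities.ResolutionOfSingularities.Theorems.FInjectiveMacaulayfication

/-! ## The point-centre of a point-fixable point, on a prescribed affine chart -/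

/-- **The point-centre of the spread-out centre.** `X₁` locally Noetherian, `b` a closed point of an affine open `U`, `(c)` an
`𝔪_b`-primary ideal of `𝒪_{X₁,b}` (`(c) ≠ 0`, `√(c) = 𝔪_b`) whose affine blowup algebras satisfy the full clause at the primes over
`𝔪_b`. Then the point-centre ideal sheaf `J` of `Ĩ := (c) ∩ Γ(X₁, U)` (`PointCentreIdealSheaf.stub_pointCentreIdealSheaf`) has
`J(U) = Ĩ`, `supp J = {b}`, and EVERY blowing up along `J` satisfies the full clause at every point over `b` (`J_b = (c)` by
`Literature…stalkIdeal_eq_map_germ` + `IsLocalization.map_under`; the dictionary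
`Literature…IsBlowup.exists_blowupAlgebra_stalk_ringEquiv_of_eq`, Stacks 0804). [folklore] -/
theorem exists_pointCentre_of_pointFixable (p : ℕ) (X₁ : Scheme.{0}) [IsLocallyNoetherian X₁] (b : X₁)
    (hb : IsClosed ({b} : Set X₁)) (U : X₁.affineOpens) (hbU : b ∈ (U : X₁.Opens))
    (n : ℕ) (c : Fin n → X₁.presheaf.stalk b) (hc0 : Ideal.span (Set.range c) ≠ ⊥)
    (hrad : (Ideal.span (Set.range c)).radical = IsLocalRing.maximalIdeal (X₁.presheaf.stalk b))
    (hgood : ∀ (j : Fin n) (𝔔 : PrimeSpectrum (Literature.AlgebraicGeometry.Resolution.blowupAlgebra (Ideal.span (Set.range c)) (c j))),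
      𝔔.asIdeal.comap (algebraMap (X₁.presheaf.stalk b) (Literature.AlgebraicGeometry.Resolution.blowupAlgebra (Ideal.span (Set.range c)) (c j))) = IsLocalRing.maximalIdeal (X₁.presheaf.stalk b) →
      IsDomain (Localization.AtPrime 𝔔.asIdeal) ∧ ∀ d : ℕ, ringKrullDim (Localization.AtPrime 𝔔.asIdeal) = d → ∀ s : Fin d → Localization.AtPrime 𝔔.asIdeal, (Ideal.span (Set.range s)).radical.IsMaximal → RingTheory.Sequence.IsWeaklyRegular (Localization.AtPrime 𝔔.asIdeal) (List.ofFn s) ∧ ∀ y : Localization.AtPrime 𝔔.asIdeal, (∃ e : ℕ, y ^ p ^ e ∈ Ideal.span ((fun z : Localization.AtPrime 𝔔.asIdeal => z ^ p ^ e) '' (Ideal.span (Set.range s) : Set (Localization.AtPrime 𝔔.asIdeal)))) → y ∈ Ideal.span (Set.range s)) :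
    letI := TopCat.Presheaf.algebra_section_stalk X₁.presheaf (⟨b, hbU⟩ : (U : X₁.Opens))
    ∃ J : X₁.IdealSheafData, J.ideal U = (Ideal.span (Set.range c)).under Γ(X₁, U) ∧ (J.support : Set X₁) = {b} ∧
      ∀ (X' : Scheme.{0}) (π : X' ⟶ X₁), IsBlowup π J →
        ∀ x' : X', π.base x' = b → IsDomain (X'.presheaf.stalk x') ∧ ∀ d : ℕ, ringKrullDim (X'.presheaf.stalk x') = d → ∀ s : Fin d → X'.presheaf.stalk x', (Ideal.span (Set.range s)).radical.IsMaximal → RingTheory.Sequence.IsWeaklyRegular (X'.presheaf.stalk x') (List.ofFn s) ∧ ∀ y : X'.presheaf.stalk x', (∃ e : ℕ, y ^ p ^ e ∈ Ideal.span ((fun z : X'.presheaf.stalk x' => z ^ p ^ e) '' (Ideal.span (Set.range s) : Set (X'.presheaf.stalk x')))) → y ∈ Ideal.span (Set.range s) := by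
  letI := TopCat.Presheaf.algebra_section_stalk X₁.presheaf (⟨b, hbU⟩ : (U : X₁.Opens))
  haveI : IsLocalization.AtPrime (X₁.presheaf.stalk b) (U.2.primeIdealOf ⟨b, hbU⟩).asIdeal :=
    U.2.isLocalization_stalk ⟨b, hbU⟩
  have hmap : ((Ideal.span (Set.range c)).under Γ(X₁, U)).map (algebraMap Γ(X₁, U) (X₁.presheaf.stalk b)) =
      Ideal.span (Set.range c) :=
    IsLocalization.map_under (U.2.primeIdealOf ⟨b, hbU⟩).asIdeal.primeCompl (X₁.presheaf.stalk b) _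
  have hzero : ∀ (x : X₁) (hx : x ∈ (U : X₁.Opens)),
      (Ideal.span (Set.range c)).under Γ(X₁, U) ≤ (U.2.primeIdealOf ⟨x, hx⟩).asIdeal ↔ x = b :=
    fun x hx => PointFixableCentre.under_le_primeIdealOf_iff X₁ U b hbU hb _ hrad x hx
  obtain ⟨J, hJU, hsupp, -⟩ := PointCentreIdealSheaf.stub_pointCentreIdealSheaf X₁ U _ b hbU hb hzero
  refine ⟨J, hJU, hsupp, fun X' π hπ x' hx' => ?_⟩
  obtain rfl : π.base x' = b := hx'
  have hst : stalkIdeal J (π.base x') = Ideal.span (Set.range c) := by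
    rw [stalkIdeal_eq_map_germ J U hbU, hJU]
    exact hmap
  obtain ⟨j, 𝔔, -, e, -, -, -, h𝔔⟩ :=
    hπ.exists_blowupAlgebra_stalk_ringEquiv_of_eq x' c (Ideal.span (Set.range c)) rfl hst.symm
  obtain ⟨hdom, hq⟩ := hgood j 𝔔 h𝔔
  haveI := hdom
  exact ⟨MulEquiv.isDomain (Localization.AtPrime 𝔔.asIdeal) e.toMulEquiv,
    DegreeZeroDescent.inlineClause_of_ringEquiv p (L := Localization.AtPrime 𝔔.asIdeal) (L' := X'.presheaf.stalk x') e.symm hq⟩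

/-- **From blowing ups along the point-centre to the affine blowing up of the chart.** If every blowing up of `X₁` along `J` is
good over `b`, then every stalk of `affineBlowup (J(U))` over `b` is good: a blowing up `π : X' ⟶ X₁` along `J` exists
(`Literature…exists_isBlowup`) and `affineBlowup (J(U)) ⟶ X'` is an open immersion over `U → X₁`
(`IsBlowup.exists_chartImmersion`), so the stalk at `y` is the stalk of `X'` at a point over the same base point. [folklore] -/
theorem affineBlowupClause_of_pointCentre (p : ℕ) (X₁ : Scheme.{0}) (U : X₁.affineOpens) (b : X₁) (J : X₁.IdealSheafData)
    (I : Ideal Γ(X₁, U)) (hJU : J.ideal U = I)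
    (hgood : ∀ (X' : Scheme.{0}) (π : X' ⟶ X₁), IsBlowup π J →
      ∀ x' : X', π.base x' = b → IsDomain (X'.presheaf.stalk x') ∧ ∀ d : ℕ, ringKrullDim (X'.presheaf.stalk x') = d → ∀ s : Fin d → X'.presheaf.stalk x', (Ideal.span (Set.range s)).radical.IsMaximal → RingTheory.Sequence.IsWeaklyRegular (X'.presheaf.stalk x') (List.ofFn s) ∧ ∀ y : X'.presheaf.stalk x', (∃ e : ℕ, y ^ p ^ e ∈ Ideal.span ((fun z : X'.presheaf.stalk x' => z ^ p ^ e) '' (Ideal.span (Set.range s) : Set (X'.presheaf.stalk x')))) → y ∈ Ideal.span (Set.range s)) :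
    ∀ y : ↥(affineBlowup I), (affineBlowup.π I ≫ U.2.fromSpec).base y = b →
      IsDomain ((affineBlowup I).presheaf.stalk y) ∧ ∀ d : ℕ, ringKrullDim ((affineBlowup I).presheaf.stalk y) = d → ∀ s : Fin d → (affineBlowup I).presheaf.stalk y, (Ideal.span (Set.range s)).radical.IsMaximal → RingTheory.Sequence.IsWeaklyRegular ((affineBlowup I).presheaf.stalk y) (List.ofFn s) ∧ ∀ z : (affineBlowup I).presheaf.stalk y, (∃ e : ℕ, z ^ p ^ e ∈ Ideal.span ((fun w : (affineBlowup I).presheaf.stalk y => w ^ p ^ e) '' (Ideal.span (Set.range s) : Set ((affineBlowup I).presheaf.stalk y)))) → z ∈ Ideal.span (Set.range s) := by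
  subst hJU
  intro y hy
  obtain ⟨X', π, hπ⟩ := exists_isBlowup X₁ J
  obtain ⟨φ, hφ, hcomm, -⟩ := hπ.exists_chartImmersion U
  have hb : π.base (φ.base y) = b := by
    rw [← hy, ← hcomm]
    rfl
  exact fiClause_of_ringEquiv p (asIso (φ.stalkMap y)).commRingCatIsoToRingEquiv (hgood X' π hπ (φ.base y) hb)

/-! ## §5g Point-fixable bad points are locally fixable -/

/-- **§5g — POINT-FIXABLE ⇒ LOCALLY FIXABLE** (`ClassGlueSig` v4 40b76d9590170192 `stub_locallyFixable_of_pointFixable`, verbatim;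
ruling R11.14; the bridge between the two presentations of the class): at a CLOSED
bad point `b` of an admissible pair `(X₁, f₁)` (separated, locally of finite type, quasi-compact over `k` of characteristic `p`,
integral, everywhere Cohen–Macaulay, finite bad set), `PFix(𝒪_{X₁,b})` implies `P_locα(b)`: all bad points are closed
(`BadPointsClosed.stub_badPointsClosed`), so inside any `W ∋ b` an affine `U ∋ b` misses the other (finitely many, closed) bad
points; `char Γ(X₁, U) = p`; the spread-out centre `Ĩ = (c) ∩ Γ(X₁, U) ≠ 0` has zero locus `{b}`
(`PointFixableCentre.under_le_primeIdealOf_iff`); and every stalk of `affineBlowup Ĩ` over `b` is good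
(`exists_pointCentre_of_pointFixable` + `affineBlowupClause_of_pointCentre`). [folklore] -/
theorem locallyFixable_of_pointFixable : ∀ (p : ℕ), p.Prime → ∀ (k : Type) [Field k] [CharP k p]
    (X₁ : Scheme.{0}) (f₁ : X₁ ⟶ Spec (.of k)),
      IsSeparated f₁ → LocallyOfFiniteType f₁ → QuasiCompact f₁ → IsIntegral X₁ →
      (∀ x : X₁, ∀ d : ℕ, ringKrullDim (X₁.presheaf.stalk x) = d → ∀ s : Fin d → X₁.presheaf.stalk x, (Ideal.span (Set.range s)).radical.IsMaximal → RingTheory.Sequence.IsWeaklyRegular (X₁.presheaf.stalk x) (List.ofFn s)) →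
      Set.Finite {x : X₁ | ¬ ∀ d : ℕ, ringKrullDim (X₁.presheaf.stalk x) = d → ∀ s : Fin d → X₁.presheaf.stalk x, (Ideal.span (Set.range s)).radical.IsMaximal → ∀ y : X₁.presheaf.stalk x, (∃ e : ℕ, y ^ p ^ e ∈ Ideal.span ((fun z : X₁.presheaf.stalk x => z ^ p ^ e) '' (Ideal.span (Set.range s) : Set (X₁.presheaf.stalk x)))) → y ∈ Ideal.span (Set.range s)} →
      ∀ b : X₁, IsClosed ({b} : Set X₁) → (¬ ∀ d : ℕ, ringKrullDim (X₁.presheaf.stalk b) = d → ∀ s : Fin d → X₁.presheaf.stalk b, (Ideal.span (Set.range s)).radical.IsMaximal → ∀ y : X₁.presheaf.stalk b, (∃ e : ℕ, y ^ p ^ e ∈ Ideal.span ((fun z : X₁.presheaf.stalk b => z ^ p ^ e) '' (Ideal.span (Set.range s) : Set (X₁.presheaf.stalk b)))) → y ∈ Ideal.span (Set.range s)) →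
      (∃ (n : ℕ) (c : Fin n → X₁.presheaf.stalk b), Ideal.span (Set.range c) ≠ ⊥ ∧ (Ideal.span (Set.range c)).radical = IsLocalRing.maximalIdeal (X₁.presheaf.stalk b) ∧
        ∀ (j : Fin n) (𝔔 : PrimeSpectrum (Literature.AlgebraicGeometry.Resolution.blowupAlgebra (Ideal.span (Set.range c)) (c j))),
          𝔔.asIdeal.comap (algebraMap (X₁.presheaf.stalk b) (Literature.AlgebraicGeometry.Resolution.blowupAlgebra (Ideal.span (Set.range c)) (c j))) = IsLocalRing.maximalIdeal (X₁.presheaf.stalk b) →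
          IsDomain (Localization.AtPrime 𝔔.asIdeal) ∧ ∀ d : ℕ, ringKrullDim (Localization.AtPrime 𝔔.asIdeal) = d → ∀ s : Fin d → Localization.AtPrime 𝔔.asIdeal, (Ideal.span (Set.range s)).radical.IsMaximal → RingTheory.Sequence.IsWeaklyRegular (Localization.AtPrime 𝔔.asIdeal) (List.ofFn s) ∧ ∀ y : Localization.AtPrime 𝔔.asIdeal, (∃ e : ℕ, y ^ p ^ e ∈ Ideal.span ((fun z : Localization.AtPrime 𝔔.asIdeal => z ^ p ^ e) '' (Ideal.span (Set.range s) : Set (Localization.AtPrime 𝔔.asIdeal)))) → y ∈ Ideal.span (Set.range s)) →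
      (∀ W : X₁.Opens, b ∈ W → ∃ U : X₁.affineOpens, (U : X₁.Opens) ≤ W ∧ b ∈ (U : X₁.Opens) ∧
        (∀ x : X₁, x ∈ (U : X₁.Opens) → x ≠ b → ∀ d : ℕ, ringKrullDim (X₁.presheaf.stalk x) = d → ∀ s : Fin d → X₁.presheaf.stalk x, (Ideal.span (Set.range s)).radical.IsMaximal → ∀ y : X₁.presheaf.stalk x, (∃ e : ℕ, y ^ p ^ e ∈ Ideal.span ((fun z : X₁.presheaf.stalk x => z ^ p ^ e) '' (Ideal.span (Set.range s) : Set (X₁.presheaf.stalk x)))) → y ∈ Ideal.span (Set.range s)) ∧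
        CharP Γ(X₁, U) p ∧ ∃ (I : Ideal Γ(X₁, U)), I ≠ ⊥ ∧
        (∀ (x : X₁) (hx : x ∈ (U : X₁.Opens)), I ≤ (U.2.primeIdealOf ⟨x, hx⟩).asIdeal ↔ x = b) ∧
        ∀ y : ↥(affineBlowup I), (affineBlowup.π I ≫ U.2.fromSpec).base y = b →
          IsDomain ((affineBlowup I).presheaf.stalk y) ∧ ∀ d : ℕ, ringKrullDim ((affineBlowup I).presheaf.stalk y) = d → ∀ s : Fin d → (affineBlowup I).presheaf.stalk y, (Ideal.span (Set.range s)).radical.IsMaximal → RingTheory.Sequence.IsWeaklyRegular ((affineBlowup I).presheaf.stalk y) (List.ofFn s) ∧ ∀ z : (affineBlowup I).presheaf.stalk y, (∃ e : ℕ, z ^ p ^ e ∈ Ideal.span ((fun w : (affineBlowup I).presheaf.stalk y => w ^ p ^ e) '' (Ideal.span (Set.range s) : Set ((affineBlowup I).presheaf.stalk y)))) → z ∈ Ideal.span (Set.range s)) := by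
  intro p hp k _ _ X₁ f₁ _ hft hqc hint hCM hfin b hb _ hfix W hbW
  classical
  obtain ⟨n, c, hc0, hrad, hgood⟩ := hfix
  haveI : Fact p.Prime := ⟨hp⟩
  haveI := hft
  haveI := hqc
  haveI : IsNoetherian X₁ := ClosedPointsOfClosedFinite.isNoetherian_of_locallyOfFiniteType_of_quasiCompact f₁
  -- the OTHER bad points form a closed set (bad points are closed, and there are finitely many)
  have hScl : IsClosed ({x : X₁ | ¬ ∀ d : ℕ, ringKrullDim (X₁.presheaf.stalk x) = d → ∀ s : Fin d → X₁.presheaf.stalk x, (Ideal.span (Set.range s)).radical.IsMaximal → ∀ y : X₁.presheaf.stalk x, (∃ e : ℕ, y ^ p ^ e ∈ Ideal.span ((fun z : X₁.presheaf.stalk x => z ^ p ^ e) '' (Ideal.span (Set.range s) : Set (X₁.presheaf.stalk x)))) → y ∈ Ideal.span (Set.range s)} \ {b}) := by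
    have h := (hfin.subset Set.sdiff_subset).isClosed_biUnion
      (fun x (hx : x ∈ {x : X₁ | ¬ ∀ d : ℕ, ringKrullDim (X₁.presheaf.stalk x) = d → ∀ s : Fin d → X₁.presheaf.stalk x, (Ideal.span (Set.range s)).radical.IsMaximal → ∀ y : X₁.presheaf.stalk x, (∃ e : ℕ, y ^ p ^ e ∈ Ideal.span ((fun z : X₁.presheaf.stalk x => z ^ p ^ e) '' (Ideal.span (Set.range s) : Set (X₁.presheaf.stalk x)))) → y ∈ Ideal.span (Set.range s)} \ {b}) =>
        BadPointsClosed.stub_badPointsClosed p hp k X₁ f₁ hft hqc hCM hfin x hx.1)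
    rwa [Set.biUnion_of_singleton] at h
  -- an affine chart `U ∋ b` inside `W` missing them
  obtain ⟨U₀, hU₀, hbU, hU₀le⟩ := exists_isAffineOpen_mem_and_subset (X := X₁) (x := b)
    (U := W ⊓ ⟨({x : X₁ | ¬ ∀ d : ℕ, ringKrullDim (X₁.presheaf.stalk x) = d → ∀ s : Fin d → X₁.presheaf.stalk x, (Ideal.span (Set.range s)).radical.IsMaximal → ∀ y : X₁.presheaf.stalk x, (∃ e : ℕ, y ^ p ^ e ∈ Ideal.span ((fun z : X₁.presheaf.stalk x => z ^ p ^ e) '' (Ideal.span (Set.range s) : Set (X₁.presheaf.stalk x)))) → y ∈ Ideal.span (Set.range s)} \ {b})ᶜ, hScl.isOpen_compl⟩)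
    ⟨hbW, fun h => h.2 rfl⟩
  let U : X₁.affineOpens := ⟨U₀, hU₀⟩
  letI := TopCat.Presheaf.algebra_section_stalk X₁.presheaf (⟨b, hbU⟩ : (U : X₁.Opens))
  haveI : IsLocalization.AtPrime (X₁.presheaf.stalk b) (U.2.primeIdealOf ⟨b, hbU⟩).asIdeal :=
    U.2.isLocalization_stalk ⟨b, hbU⟩
  obtain ⟨J, hJU, -, hJgood⟩ := exists_pointCentre_of_pointFixable p X₁ b hb U hbU n c hc0 hrad hgood
  have hmap : ((Ideal.span (Set.range c)).under Γ(X₁, U)).map (algebraMap Γ(X₁, U) (X₁.presheaf.stalk b)) =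
      Ideal.span (Set.range c) :=
    IsLocalization.map_under (U.2.primeIdealOf ⟨b, hbU⟩).asIdeal.primeCompl (X₁.presheaf.stalk b) _
  have hI0 : (Ideal.span (Set.range c)).under Γ(X₁, U) ≠ ⊥ := fun h => hc0 (by rw [← hmap, h, Ideal.map_bot])
  refine ⟨U, fun x hx => (hU₀le hx).1, hbU, ?_, ?_, (Ideal.span (Set.range c)).under Γ(X₁, U), hI0,
    fun x hx => PointFixableCentre.under_le_primeIdealOf_iff X₁ U b hbU hb _ hrad x hx,
    affineBlowupClause_of_pointCentre p X₁ U b J _ hJU hJgood⟩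
  · -- `b` is the only bad point of `U`
    intro x hxU hxb
    by_contra hF
    exact (hU₀le hxU).2 ⟨hF, hxb⟩
  · -- `char Γ(X₁, U) = p`
    haveI : Nonempty (U : X₁.Opens) := ⟨⟨b, hbU⟩⟩
    haveI : IsDomain Γ(X₁, U) := IsIntegral.component_integral (U : X₁.Opens)
    exact CharP.of_ringHom_of_ne_zero ((X₁.presheaf.map (homOfLE (le_top : (U : X₁.Opens) ≤ ⊤)).op).hom.comp
      (f₁.appTop.hom.comp (Scheme.ΓSpecIso (.of k)).inv.hom)) p hp.ne_zero

/-! ## §5c THEOREM A-loc in the ring-local currency -/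

/-- **§5c — THEOREM A-loc: F-INJECTIVE MACAULAYFICATION ON THE POINT-FIXABLE CLASS** (`ClassGlueSig` v3 74b6a04e74c75940 = v4
40b76d9590170192 `fInjectiveMacaulayfication_of_pointFixable`, statement VERBATIM): every admissible pair `(X₁, f₁)` (separated, locally of finite
type, quasi-compact over `k` of characteristic `p`, integral, all local rings Cohen–Macaulay, finite bad set) ALL OF WHOSE BAD POINTS
ARE POINT-FIXABLE (`PFix(𝒪_{X₁,b})`) has a proper birational model whose stalks are domains, Cohen–Macaulay, with all parameter
ideals Frobenius closed. PROOF: bad points are closed (`BadPointsClosed.stub_badPointsClosed`), so 5g makes every bad point locally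
fixable and THEOREM A-locα (`LocallyFixable.fInjectiveMacaulayfication_of_locallyFixable`, p510664) applies. Zero named facts.
[folklore] -/
theorem fInjectiveMacaulayfication_of_pointFixable (p : ℕ) (hp : p.Prime) (k : Type) [Field k] [CharP k p]
    (X₁ : Scheme.{0}) (f₁ : X₁ ⟶ Spec (.of k)) (hsep : IsSeparated f₁) (hft : LocallyOfFiniteType f₁) (hqc : QuasiCompact f₁)
    (hint : IsIntegral X₁) (hCM : ∀ x : X₁, ∀ d : ℕ, ringKrullDim (X₁.presheaf.stalk x) = d → ∀ s : Fin d → X₁.presheaf.stalk x, (Ideal.span (Set.range s)).radical.IsMaximal → RingTheory.Sequence.IsWeaklyRegular (X₁.presheaf.stalk x) (List.ofFn s))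
    (hfin : Set.Finite {x : X₁ | ¬ ∀ d : ℕ, ringKrullDim (X₁.presheaf.stalk x) = d → ∀ s : Fin d → X₁.presheaf.stalk x, (Ideal.span (Set.range s)).radical.IsMaximal → ∀ y : X₁.presheaf.stalk x, (∃ e : ℕ, y ^ p ^ e ∈ Ideal.span ((fun z : X₁.presheaf.stalk x => z ^ p ^ e) '' (Ideal.span (Set.range s) : Set (X₁.presheaf.stalk x)))) → y ∈ Ideal.span (Set.range s)})
    (hcl : ∀ b : X₁, (¬ ∀ d : ℕ, ringKrullDim (X₁.presheaf.stalk b) = d → ∀ s : Fin d → X₁.presheaf.stalk b, (Ideal.span (Set.range s)).radical.IsMaximal → ∀ y : X₁.presheaf.stalk b, (∃ e : ℕ, y ^ p ^ e ∈ Ideal.span ((fun z : X₁.presheaf.stalk b => z ^ p ^ e) '' (Ideal.span (Set.range s) : Set (X₁.presheaf.stalk b)))) → y ∈ Ideal.span (Set.range s)) →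
      ∃ (n : ℕ) (c : Fin n → X₁.presheaf.stalk b), Ideal.span (Set.range c) ≠ ⊥ ∧ (Ideal.span (Set.range c)).radical = IsLocalRing.maximalIdeal (X₁.presheaf.stalk b) ∧
        ∀ (j : Fin n) (𝔔 : PrimeSpectrum (Literature.AlgebraicGeometry.Resolution.blowupAlgebra (Ideal.span (Set.range c)) (c j))),
          𝔔.asIdeal.comap (algebraMap (X₁.presheaf.stalk b) (Literature.AlgebraicGeometry.Resolution.blowupAlgebra (Ideal.span (Set.range c)) (c j))) = IsLocalRing.maximalIdeal (X₁.presheaf.stalk b) →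
          IsDomain (Localization.AtPrime 𝔔.asIdeal) ∧ ∀ d : ℕ, ringKrullDim (Localization.AtPrime 𝔔.asIdeal) = d → ∀ s : Fin d → Localization.AtPrime 𝔔.asIdeal, (Ideal.span (Set.range s)).radical.IsMaximal → RingTheory.Sequence.IsWeaklyRegular (Localization.AtPrime 𝔔.asIdeal) (List.ofFn s) ∧ ∀ y : Localization.AtPrime 𝔔.asIdeal, (∃ e : ℕ, y ^ p ^ e ∈ Ideal.span ((fun z : Localization.AtPrime 𝔔.asIdeal => z ^ p ^ e) '' (Ideal.span (Set.range s) : Set (Localization.AtPrime 𝔔.asIdeal)))) → y ∈ Ideal.span (Set.range s)) :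
    ∃ (X' : Scheme.{0}) (π : X' ⟶ X₁), IsProper π ∧ Literature.AlgebraicGeometry.Resolution.IsBirational π ∧
      ∀ x : X', IsDomain (X'.presheaf.stalk x) ∧ ∀ d : ℕ, ringKrullDim (X'.presheaf.stalk x) = d → ∀ s : Fin d → X'.presheaf.stalk x, (Ideal.span (Set.range s)).radical.IsMaximal → RingTheory.Sequence.IsWeaklyRegular (X'.presheaf.stalk x) (List.ofFn s) ∧ ∀ y : X'.presheaf.stalk x, (∃ e : ℕ, y ^ p ^ e ∈ Ideal.span ((fun z : X'.presheaf.stalk x => z ^ p ^ e) '' (Ideal.span (Set.range s) : Set (X'.presheaf.stalk x)))) → y ∈ Ideal.span (Set.range s) :=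
  LocallyFixable.fInjectiveMacaulayfication_of_locallyFixable p hp k X₁ f₁ hsep hft hqc hint hCM hfin
    (fun b hb => locallyFixable_of_pointFixable p hp k X₁ f₁ hsep hft hqc hint hCM hfin b
      (BadPointsClosed.stub_badPointsClosed p hp k X₁ f₁ hft hqc hCM hfin b hb) hb (hcl b hb))

end Summit.ResolutionOfSingularities.ResolutionOfSingularities.Theorems.FInjectiveMacaulayfication.OfPointFixable

end
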